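import Summits.CriticalPhenomena.CardyFormulaZ2.Theorems.CardyBoundaryCoulombGasBoundaryDefectGaussianRS17ConfigsNonemptyPart5

/-!
# Stub `s17_eventually_configsNonempty` of the D2 completion (line
# `rainbow-monomials-in-excursion-kernels`, crux `BoundaryDefectGaussianR`,
# stmt-CriticalPhenomena-14132) — Part 6: exterior darts near the boundary cycle are cycle darts

Companion of the locality lemma (Part 5), same frame reading of a large chart: under a half-plane /
convex / reflex chart of sup-radius `N ≥ 2 Dm + 4` at the vertex of the cycle dart `ds[s]`, every
EXTERIOR dart `e` (`e.1 ∈ V`, `e.1 + dir e.2 ∉ V`) whose vertex is within sup-distance `Dm` of that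
vertex is itself a cycle dart (`lc_on_cycle`, registered one-line form `s17_configsNonempty_part6`):
`e` is a chain dart of the chart (exhaustiveness, Parts 3–4) and the cycle follows the chain from
`ds[s]` far enough in both directions (`lc_reach`, from `lc_follow_fwd` / `lc_follow_bwd`). This is
what rules out, near the cells met by the collar walk, exterior faces never met by it (their level
would be the default `0`). All [folklore].
-/

namespace Summit.CriticalPhenomena.CardyFormulaZ2.Cruxes.BoundaryDefectGaussianR.RainbowMonomialsInExcursionKernels

open Literature.Probability.LatticeModels Literature.Probability.LatticeModels.CollarLegModel

/-- **Reaching a chain dart along the cycle.** With the chain followed `M` steps both ways from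
`ds[s] = γ i₀`, every `γ i'` with `|i' - i₀| ≤ M` is a cycle dart. [folklore] -/
theorem lc_reach {V : Finset (ℤ × ℤ)} {d₀ : Dart} (hv₀ : d₀.1 ∈ V) (ht₀ : dartTip d₀ ∉ V)
    (γ : ℤ → Dart) (i₀ : ℤ) (M : ℕ)
    (hsucc : ∀ i : ℤ, i₀ - M ≤ i → i < i₀ + M → dsucc V (γ i) = γ (i + 1))
    (hext : ∀ i : ℤ, i₀ - M ≤ i → i < i₀ → (γ i).1 ∈ V ∧ dartTip (γ i) ∉ V)
    {s : ℕ} (hs : s < (cycle V d₀).length) (h0 : (cycle V d₀)[s] = γ i₀)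
    {i' : ℤ} (h1 : i₀ - M ≤ i') (h2 : i' ≤ i₀ + M) :
    ∃ s', ∃ hs' : s' < (cycle V d₀).length, (cycle V d₀)[s'] = γ i' := by
  have hP : 0 < (cycle V d₀).length := by omega
  rcases le_or_gt i₀ i' with hle | hlt
  · have hf := lc_follow_fwd hv₀ ht₀ γ i₀ M (fun i hi1 hi2 => hsucc i (by omega) hi2) hs h0
      (i' - i₀).toNat (by omega)
    rw [show i₀ + ((i' - i₀).toNat : ℕ) = i' by omega] at hf
    exact ⟨_, Nat.mod_lt _ hP, hf⟩
  · have hb := lc_follow_bwd hv₀ ht₀ γ i₀ M (fun i hi1 hi2 => hsucc i hi1 (by omega)) hext hs h0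
      (i₀ - i').toNat (by omega)
    rw [show i₀ - ((i₀ - i').toNat : ℕ) = i' by omega] at hb
    exact ⟨_, Nat.mod_lt _ hP, hb⟩

/-- **Exterior darts near the cycle are cycle darts, under a large chart.** If the vertex of the
cycle dart `ds[s]` carries a half-plane / convex / reflex chart of sup-radius `N`, every EXTERIOR
dart whose vertex is within sup-distance `Dm` of it, `2 Dm + 4 ≤ N`, is a dart of the cycle (the
cycle follows the chart's chain, which exhausts the exterior darts of the box). [folklore] -/
theorem lc_on_cycle {V : Finset (ℤ × ℤ)} {d₀ : Dart} (hv₀ : d₀.1 ∈ V) (ht₀ : dartTip d₀ ∉ V)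
    {N Dm : ℕ} (hN : 2 * Dm + 4 ≤ N) {s : ℕ} (hs : s < (cycle V d₀).length) {e : Dart}
    (he : e.1 ∈ V) (het : e.1 + dir e.2 ∉ V)
    (hchart : ∃ (K : Fin 4) (c₁ c₂ : ℤ),
      (∀ v : ℤ × ℤ, |v.1 - ((cycle V d₀)[s]).1.1| ≤ N → |v.2 - ((cycle V d₀)[s]).1.2| ≤ N →
        (v ∈ V ↔ c₂ ≤ v.1 * (dir (K + 1)).1 + v.2 * (dir (K + 1)).2)) ∨
      (∀ v : ℤ × ℤ, |v.1 - ((cycle V d₀)[s]).1.1| ≤ N → |v.2 - ((cycle V d₀)[s]).1.2| ≤ N →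
        (v ∈ V ↔ c₁ ≤ v.1 * (dir K).1 + v.2 * (dir K).2 ∧
          c₂ ≤ v.1 * (dir (K + 1)).1 + v.2 * (dir (K + 1)).2)) ∨
      (∀ v : ℤ × ℤ, |v.1 - ((cycle V d₀)[s]).1.1| ≤ N → |v.2 - ((cycle V d₀)[s]).1.2| ≤ N →
        (v ∈ V ↔ c₂ ≤ v.1 * (dir (K + 1)).1 + v.2 * (dir (K + 1)).2 ∨
          v.1 * (dir K).1 + v.2 * (dir K).2 ≤ c₁)))
    (hnear : |e.1.1 - ((cycle V d₀)[s]).1.1| ≤ Dm ∧ |e.1.2 - ((cycle V d₀)[s]).1.2| ≤ Dm) :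
    ∃ s', ∃ hs' : s' < (cycle V d₀).length, (cycle V d₀)[s'] = e := by
  -- the two darts are exterior
  have hext : ∀ {t : ℕ} (ht : t < (cycle V d₀).length),
      ((cycle V d₀)[t]).1 ∈ V ∧ ((cycle V d₀)[t]).1 + dir ((cycle V d₀)[t]).2 ∉ V := by
    intro t ht
    rw [se_cycle_getElem]
    exact (s3_dsucc_iterate V t).1 d₀ hv₀ ht₀
  obtain ⟨hu, huk⟩ := hext hs
  set u : ℤ × ℤ := ((cycle V d₀)[s]).1 with hudef
  set k : Fin 4 := ((cycle V d₀)[s]).2 with hkdef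
  obtain ⟨u', k'⟩ := e
  simp only at he het hnear
  have hu' : u' ∈ V := he
  have huk' : u' + dir k' ∉ V := het
  have hds : (cycle V d₀)[s] = (u, k) := Prod.ext rfl rfl
  have hNz : (2 * Dm + 4 : ℤ) ≤ N := by exact_mod_cast hN
  have hnear' : u.1 - Dm ≤ u'.1 ∧ u'.1 ≤ u.1 + Dm ∧ u.2 - Dm ≤ u'.2 ∧ u'.2 ≤ u.2 + Dm := by
    obtain ⟨h1, h2⟩ := hnear
    rw [abs_le] at h1 h2
    omega
  obtain ⟨K, c₁, c₂, hch⟩ := hchart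
  -- the frame
  set o : ℤ × ℤ := (0 : ℤ × ℤ) + c₁ • dir K + c₂ • dir (K + 1) with ho
  set Φ : ℤ × ℤ → ℤ × ℤ := fun q => o + q.1 • dir K + q.2 • dir (K + 1) with hΦdef
  have hΦ : ∀ (q : ℤ × ℤ) (s : Fin 4), Φ q + dir (K + s) = Φ (q + dir s) :=
    fun q s => frame_add_dir K s o q
  have hoc := lc_origin_pair K c₁ c₂
  have hpair : ∀ q : ℤ × ℤ, (Φ q).1 * (dir K).1 + (Φ q).2 * (dir K).2 = c₁ + q.1 ∧
      (Φ q).1 * (dir (K + 1)).1 + (Φ q).2 * (dir (K + 1)).2 = c₂ + q.2 := by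
    intro q
    have h := frame_coord K o q
    rw [hoc.1, hoc.2] at h
    exact h
  -- the coordinates of the two vertices
  set p₀ : ℤ × ℤ := ((u.1 - o.1) * (dir K).1 + (u.2 - o.2) * (dir K).2,
    (u.1 - o.1) * (dir (K + 1)).1 + (u.2 - o.2) * (dir (K + 1)).2) with hp₀
  set p' : ℤ × ℤ := ((u'.1 - o.1) * (dir K).1 + (u'.2 - o.2) * (dir K).2,
    (u'.1 - o.1) * (dir (K + 1)).1 + (u'.2 - o.2) * (dir (K + 1)).2) with hp'
  have hu0 : Φ p₀ = u := (frame_decomp K o u).symm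
  have hu1 : Φ p' = u' := (frame_decomp K o u').symm
  have hpp : p₀.1 - Dm ≤ p'.1 ∧ p'.1 ≤ p₀.1 + Dm ∧ p₀.2 - Dm ≤ p'.2 ∧ p'.2 ≤ p₀.2 + Dm := by
    have e1 : p'.1 - p₀.1 = (u'.1 - u.1) * (dir K).1 + (u'.2 - u.2) * (dir K).2 := lc_crd_sub K o u u'
    have e2 : p'.2 - p₀.2 = (u'.1 - u.1) * (dir (K + 1)).1 + (u'.2 - u.2) * (dir (K + 1)).2 :=
      lc_crd_sub (K + 1) o u u'
    have h := lc_pair_sup K (u' - u)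
    simp only [Prod.fst_sub, Prod.snd_sub] at h
    have hm : max |u'.1 - u.1| |u'.2 - u.2| ≤ Dm := max_le hnear.1 hnear.2
    have a1 := abs_le.1 ((h.1.trans hm))
    have a2 := abs_le.1 ((h.2.trans hm))
    omega
  -- the frame box of radius `N` about `p₀` lies in the chart box
  have hbox : ∀ q : ℤ × ℤ, p₀.1 - N ≤ q.1 → q.1 ≤ p₀.1 + N → p₀.2 - N ≤ q.2 → q.2 ≤ p₀.2 + N →
      |(Φ q).1 - u.1| ≤ N ∧ |(Φ q).2 - u.2| ≤ N := by
    intro q h1 h2 h3 h4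
    have e : Φ q - u = (q.1 - p₀.1) • dir K + (q.2 - p₀.2) • dir (K + 1) := by
      rw [← hu0]; exact lc_frame_sub K o q p₀
    have hsup := lc_frame_sup K (q.1 - p₀.1) (q.2 - p₀.2)
    have hm : max |q.1 - p₀.1| |q.2 - p₀.2| ≤ N :=
      max_le (abs_le.2 ⟨by omega, by omega⟩) (abs_le.2 ⟨by omega, by omega⟩)
    rw [show (Φ q).1 - u.1 = (Φ q - u).1 from rfl, show (Φ q).2 - u.2 = (Φ q - u).2 from rfl, e]
    exact ⟨hsup.1.trans hm, hsup.2.trans hm⟩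
  -- the two darts in the frame
  obtain ⟨r₀, hr₀⟩ := lc_rel_dir K k
  obtain ⟨r', hr'⟩ := lc_rel_dir K k'
  have hin0 : Φ p₀ ∈ V := by rw [hu0]; exact hu
  have hout0 : Φ p₀ + dir (K + r₀) ∉ V := by rw [hu0, ← hr₀]; exact huk
  have hin1 : Φ p' ∈ V := by rw [hu1]; exact hu'
  have hout1 : Φ p' + dir (K + r') ∉ V := by rw [hu1, ← hr']; exact huk'
  set M : ℕ := 2 * Dm + 1 with hM
  have hMz : (M : ℤ) = 2 * Dm + 1 := by rw [hM]; push_cast; ring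
  rcases hch with hch | hch | hch
  · -- half-plane chart
    have hW : ∀ q : ℤ × ℤ, p₀.1 - N ≤ q.1 → q.1 ≤ p₀.1 + N → p₀.2 - N ≤ q.2 → q.2 ≤ p₀.2 + N →
        (Φ q ∈ V ↔ 0 ≤ q.2) := by
      intro q h1 h2 h3 h4
      obtain ⟨b1, b2⟩ := hbox q h1 h2 h3 h4
      rw [hch (Φ q) b1 b2, (hpair q).2]
      constructor <;> intro h <;> linarith
    obtain ⟨hq0, hr0⟩ := lc_H_exhaust hΦ hW p₀ r₀ (by omega) (by omega) (by omega) (by omega)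
      hin0 hout0
    obtain ⟨hq1, hr1⟩ := lc_H_exhaust hΦ hW p' r' (by omega) (by omega) (by omega) (by omega)
      hin1 hout1
    have h0 : (cycle V d₀)[s] = (Φ (p₀.1, 0), K + 3) := by
      have e : ((p₀.1, 0) : ℤ × ℤ) = p₀ := Prod.ext rfl hq0.symm
      rw [hds, e, hu0, hr₀, hr0]
    have h' : ((u', k') : Dart) = (Φ (p'.1, 0), K + 3) := by
      have e : ((p'.1, 0) : ℤ × ℤ) = p' := Prod.ext rfl hq1.symm
      rw [e, hu1, hr', hr1]
    rw [h']
    exact lc_reach hv₀ ht₀ (fun i : ℤ => ((Φ (i, 0), K + 3) : Dart)) p₀.1 M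
      (fun i hi1 hi2 => (lc_H_chain hΦ hW (by omega) (by omega) i (by omega) (by omega)).2.2)
      (fun i hi1 hi2 => ⟨(lc_H_chain hΦ hW (by omega) (by omega) i (by omega) (by omega)).1,
        (lc_H_chain hΦ hW (by omega) (by omega) i (by omega) (by omega)).2.1⟩)
      hs h0 (i' := p'.1) (by omega) (by omega)
  · -- convex chart
    have hW : ∀ q : ℤ × ℤ, p₀.1 - N ≤ q.1 → q.1 ≤ p₀.1 + N → p₀.2 - N ≤ q.2 → q.2 ≤ p₀.2 + N →
        (Φ q ∈ V ↔ 0 ≤ q.1 ∧ 0 ≤ q.2) := by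
      intro q h1 h2 h3 h4
      obtain ⟨b1, b2⟩ := hbox q h1 h2 h3 h4
      rw [hch (Φ q) b1 b2, (hpair q).1, (hpair q).2]
      constructor <;> rintro ⟨ha, hb⟩ <;> constructor <;> linarith
    set γ : ℤ → Dart := fun i => if i ≤ 0 then (Φ (0, -i), K + 2) else (Φ (i - 1, 0), K + 3)
      with hγ
    obtain ⟨i₀, h0', hi₀⟩ := lc_Q_index hΦ hW γ (fun _ => rfl) p₀ r₀ (by omega) (by omega)
      (by omega) (by omega) hin0 hout0
    obtain ⟨i', h1', hi'⟩ := lc_Q_index hΦ hW γ (fun _ => rfl) p' r' (by omega) (by omega)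
      (by omega) (by omega) hin1 hout1
    have h0 : (cycle V d₀)[s] = γ i₀ := by rw [hds, ← h0', hu0, hr₀]
    have h' : ((u', k') : Dart) = γ i' := by rw [← h1', hu1, hr']
    rw [h']
    exact lc_reach hv₀ ht₀ γ i₀ M
      (fun i hi1 hi2 => (lc_Q_chain_sharp hΦ hW γ (fun _ => rfl) i (fun hi => by omega)
        (fun hi => by omega)).2.2)
      (fun i hi1 hi2 => ⟨(lc_Q_chain_sharp hΦ hW γ (fun _ => rfl) i (fun hi => by omega)
        (fun hi => by omega)).1, (lc_Q_chain_sharp hΦ hW γ (fun _ => rfl) i (fun hi => by omega)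
        (fun hi => by omega)).2.1⟩)
      hs h0 (i' := i') (by omega) (by omega)
  · -- reflex chart
    have hW : ∀ q : ℤ × ℤ, p₀.1 - N ≤ q.1 → q.1 ≤ p₀.1 + N → p₀.2 - N ≤ q.2 → q.2 ≤ p₀.2 + N →
        (Φ q ∈ V ↔ 0 ≤ q.2 ∨ q.1 ≤ 0) := by
      intro q h1 h2 h3 h4
      obtain ⟨b1, b2⟩ := hbox q h1 h2 h3 h4
      rw [hch (Φ q) b1 b2, (hpair q).1, (hpair q).2]
      constructor <;> rintro (ha | ha)
      · left; linarith
      · right; linarith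
      · left; linarith
      · right; linarith
    set γ : ℤ → Dart := fun i => if i ≤ 0 then (Φ (0, i - 1), K + 0) else (Φ (i, 0), K + 3)
      with hγ
    obtain ⟨i₀, h0', hi₀⟩ := lc_R_index hΦ hW γ (fun _ => rfl) p₀ r₀ (by omega) (by omega)
      (by omega) (by omega) hin0 hout0
    obtain ⟨i', h1', hi'⟩ := lc_R_index hΦ hW γ (fun _ => rfl) p' r' (by omega) (by omega)
      (by omega) (by omega) hin1 hout1
    have h0 : (cycle V d₀)[s] = γ i₀ := by rw [hds, ← h0', hu0, hr₀]
    have h' : ((u', k') : Dart) = γ i' := by rw [← h1', hu1, hr']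
    rw [h']
    exact lc_reach hv₀ ht₀ γ i₀ M
      (fun i hi1 hi2 => (lc_R_chain_sharp hΦ hW γ (fun _ => rfl) i (fun hi => by omega)
        (fun hi => by omega)).2.2)
      (fun i hi1 hi2 => ⟨(lc_R_chain_sharp hΦ hW γ (fun _ => rfl) i (fun hi => by omega)
        (fun hi => by omega)).1, (lc_R_chain_sharp hΦ hW γ (fun _ => rfl) i (fun hi => by omega)
        (fun hi => by omega)).2.1⟩)
      hs h0 (i' := i') (by omega) (by omega)


/-! ### Registered one-line form -/

/-- **Registered sub-goal `s17_configsNonempty_part6`** of `s17_eventually_configsNonempty`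
(stmt-CriticalPhenomena-14132): under a half-plane / convex / reflex chart of sup-radius
`N ≥ 2 Dm + 4` at the vertex of the cycle dart `ds[s]`, every exterior dart with vertex within
sup-distance `Dm` of it is a cycle dart (one-line form of `lc_on_cycle`). [folklore] -/
theorem s17_configsNonempty_part6 : ∀ (V : Finset (ℤ × ℤ)) (d₀ : Literature.Probability.LatticeModels.CollarLegModel.Dart), d₀.1 ∈ V → Literature.Probability.LatticeModels.CollarLegModel.dartTip d₀ ∉ V → ∀ (N Dm : ℕ), 2 * Dm + 4 ≤ N → ∀ (s : ℕ) (hs : s < (Literature.Probability.LatticeModels.CollarLegModel.cycle V d₀).length) (e : Literature.Probability.LatticeModels.CollarLegModel.Dart), e.1 ∈ V → e.1 + Literature.Probability.LatticeModels.CollarLegModel.dir e.2 ∉ V → (∃ (K : Fin 4) (c₁ c₂ : ℤ), (∀ v : ℤ × ℤ, |v.1 - ((Literature.Probability.LatticeModels.CollarLegModel.cycle V d₀)[s]).1.1| ≤ N → |v.2 - ((Literature.Probability.LatticeModels.CollarLegModel.cycle V d₀)[s]).1.2| ≤ N → (v ∈ V ↔ c₂ ≤ v.1 * (Literature.Probability.LatticeModels.CollarLegModel.dir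 (K + 1)).1 + v.2 * (Literature.Probability.LatticeModels.CollarLegModel.dir (K + 1)).2)) ∨ (∀ v : ℤ × ℤ, |v.1 - ((Literature.Probability.LatticeModels.CollarLegModel.cycle V d₀)[s]).1.1| ≤ N → |v.2 - ((Literature.Probability.LatticeModels.CollarLegModel.cycle V d₀)[s]).1.2| ≤ N → (v ∈ V ↔ c₁ ≤ v.1 * (Literature.Probability.LatticeModels.CollarLegModel.dir K).1 + v.2 * (Literature.Probability.LatticeModels.CollarLegModel.dir K).2 ∧ c₂ ≤ v.1 * (Literature.Probability.LatticeModels.CollarLegModel.dir (K + 1)).1 + v.2 * (Literature.Probability.LatticeModels.CollarLegModel.dir (K + 1)).2)) ∨ (∀ v : ℤ × ℤ, |v.1 - ((Literature.Probability.LatticeModels.CollarLegModel.cycle V d₀)[s]).1.1| ≤ N → |v.2 - ((Literature.Probability.LatticeModels.CollarLegModel.cycle V d₀)[s]).1.2| ≤ N → (v ∈ V ↔ c₂ ≤ v.1 * (Literature.Probability.LatticeModels.CollarLegModel.dir (K + 1)).1 + v.2 * (Literature.Probability.LatticeModels.CollarLegModel.dir (K + 1)).2 ∨ v.1 * (Literature.Probability.LatticeModels.CollarLegModel.dir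 K).1 + v.2 * (Literature.Probability.LatticeModels.CollarLegModel.dir K).2 ≤ c₁))) → |e.1.1 - ((Literature.Probability.LatticeModels.CollarLegModel.cycle V d₀)[s]).1.1| ≤ Dm ∧ |e.1.2 - ((Literature.Probability.LatticeModels.CollarLegModel.cycle V d₀)[s]).1.2| ≤ Dm → ∃ s', ∃ hs' : s' < (Literature.Probability.LatticeModels.CollarLegModel.cycle V d₀).length, (Literature.Probability.LatticeModels.CollarLegModel.cycle V d₀)[s'] = e :=
  fun _ _ hv₀ ht₀ _ _ hN _ hs _ he het hchart hnear => lc_on_cycle hv₀ ht₀ hN hs he het hchart hnear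

end Summit.CriticalPhenomena.CardyFormulaZ2.Cruxes.BoundaryDefectGaussianR.RainbowMonomialsInExcursionKernels
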